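import Mathlib
import HarnessLib

/-!
# Venture HSemireg — LEMMA P (Walsh–parity lower bound) of the g = 8 family-B census at n = 4: a unit-graph design on E_i⁴ × E_i⁴ whose
# mixed-sign full moments vanish and whose moment m̂(+,+,+,+) is non-zero has AT LEAST 8 = 2^{n−1} letters in its support — the
# Walsh–Hadamard inversion on (ℤ∕2)⁴ as a kernel `decide` plus integer bookkeeping in ℤ[i]

HONEST FRAMING. Part of the Lean index of the computation cell `pub-hsemireg` (Sunday typer seat p9, § g = 8; family B rows **B20-k** of
`target-g8/CENSUS.md` v1.274 `7744dc4867915f69`, in particular the minimality words «LEMMA P, B20-4: minimum 8 at n = 4» and «LEMMA P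
bound 2^(n−1)» for the design Z₈). FINITE GAUSSIAN-INTEGER ARITHMETIC ONLY: functions `m : (ℤ∕4)⁴ → ℤ` («designs», by their
exponent vectors), the sixteen characters `x ↦ i^{ε·x}` (`ε ∈ {±1}⁴`), their moments, and a count of the support. No abelian variety,
graph Γ_D, cycle, class or filler is constructed; LEMMA W (the criterion «class-completable ⟺ all mixed full moments vanish; W-alive ⟺
m̂(1,…,1) ≠ 0») is the DICTIONARY that makes the hypotheses below the census's hypotheses — TEXT OF RECORD, not a binder and not proved
here; nothing here says that HC ∕ HC_CM ∕ HC_AV holds; no object is certified; no Literature fact is declared.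

TEXTS OF RECORD (quoted, not interpreted). Source: t-20, `target-g8/FAMILY-B-G8-t20.md` v1.25 `987a3ee140325c40`. §1 FRAME: «A
unit-graph DESIGN is m : μ_Kⁿ → ℤ (ℤ_{≥0} = effective), Γ_D = Π_k Γ_{D_k} = graph of the diagonal matrix D; for K = ℚ(i) write D_k =
i^{x_k}, x ∈ (ℤ/4)ⁿ, and m̂(ε) := Σ_x m(x) i^{ε·x} for ε ∈ {0,±1}ⁿ.» §2.1 LEMMA W (dictionary, NOT proved here): «an effective unit-graph
design extends by effective fillers to a CLASS-EXACT cycle iff m̂(ε) = 0 for every mixed-sign ε ∈ {±1}ⁿ (2ⁿ − 2 conditions; 14 at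
n = 4), and the result is W-ALIVE iff m̂(1,…,1) ≠ 0.» §2.2 LEMMA P (typed here at n = 4): «For ε ∈ {±1}ⁿ, i^{ε·x} =
i^{|x|}·(−1)^{Σ_{k: ε_k = −1} x_k}, so with S_p := Σ_{x ≡ p (mod 2)} m(x) i^{|x|} (p ∈ (ℤ/2)ⁿ) the vector (m̂(ε))_ε is the
Walsh–Hadamard transform of (S_p)_p. The conditions «m̂ = 0 at mixed ε, m̂(+1ⁿ) = α» invert to S_p = 2^{−n}(α + (−1)^{|p|}ᾱ), i.e. S_p =
Re α/2^{n−1} for |p| even and i·Im α/2^{n−1} for |p| odd. α ≠ 0 ⇒ at least 2^{n−1} parity classes carry support ⇒ every (effective or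
signed) class-completable W-alive unit-graph design has ≥ 2^{n−1} graphs, with equality iff the support is one letter-vector in each
class of one parity family with m(x)i^{|x|} constant.» Census B20-4 c-cells: «LEMMA P, B20-4: minimum 8 at n = 4».

WHAT THIS FILE PROVES (kernel, n = 4 throughout; `Letter = Fin 4 → Fin 4` = exponent vectors x, `Sgn = Fin 4 → Fin 2` = sign
patterns δ with ε_k = (−1)^{δ_k}, also used for parity classes p). `ipow k` = i^k by k mod 4 (`ipow_eq_pow`: it IS `⟨0,1⟩^k` in
`GaussianInt`); `chi δ x` = i^{ε(δ)·x} (ε_k x_k taken as x_k or 3x_k mod 4); `wsign δ p` = (−1)^{δ·p}; `moment m δ` = m̂(ε(δ)) =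
Σ_x m(x)·i^{ε·x}; `S m p` = Σ_{x ≡ p} m(x)·i^{|x|}. THEOREMS: `chi_eq_ipow_wt_mul_sign` (the first sentence of LEMMA P: i^{ε·x} =
i^{|x|}·(−1)^{Σ_{δ_k=1} x_k}, all δ, x — kernel `decide`); `walsh_pointwise` (Σ_δ (−1)^{δ·p} i^{ε(δ)·x} = 16·[x ≡ p]·i^{|x|} — the
orthogonality behind the inversion, kernel `decide`, 4096 × 16 terms); **`inversion`** (16·S_p = Σ_δ (−1)^{δ·p} m̂(δ), every m, p);
`moment_neg_eq_star` (m̂(−,−,−,−) = conj m̂(+,+,+,+) for integer m); **`S_formula`** (mixed moments zero ⇒ 16·S_p = α + (−1)^{|p|}·ᾱ);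
`exists_support_of_S_ne_zero`; **`eight_le_card_support`** = LEMMA P at n = 4: mixed moments zero ∧ α ≠ 0 ⇒ #{x : m(x) ≠ 0} ≥ 8, for
every INTEGER-valued m (effective or signed); corollary `moment_zero_eq_zero_of_card_lt_eight` (support < 8 and mixed moments 0 ⇒
W-dead — t-20 §2.4 (a) «≤ 3 graphs … W-DEAD» and more). NON-VACUITY: `z8_moments` — t-20's minimal design Z₈ (§2.3: letters (1,1,1,1), (1,1,−i,i),
(1,−i,1,i), (1,−i,i,1), (i,i,i,i), (−i,1,1,i), (−i,1,i,1), (−i,i,1,1), i.e. exponent vectors 0000, 0031, 0301, 0310, 1111, 3001, 3010,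
3100) has all 14 mixed moments 0, α = m̂(+⁴) = 8 ≠ 0 and exactly 8 letters — so the bound is ATTAINED (kernel `decide`).

WHAT IS NOT HERE. LEMMA W itself (the e-word expansion and the Walsh cascade — the dictionary from designs to class-exact cycles),
the «if» half of the «equality iff» clause of LEMMA P (§5, appended, proves the «only if» half: `sixteen_le_card_support`,
`re_eq_zero_or_im_eq_zero_of_card_eq_eight`, `card_eq_eight_shape_even`), the odd-family twin of the last, general n (the statement is typed at the census level n = 4 only; the proof pattern is uniform),
the ℚ(ω) point (§2.7), and every member computation of §3.
-/

namespace Summit.Ventures.HSemireg.WalshParity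

open Finset

/-- Exponent vectors `x ∈ (ℤ∕4)⁴`: the letter of factor `k` is the unit `i^{x_k}` (t-20 §1 «D_k = i^{x_k}, x ∈ (ℤ/4)ⁿ»).
[definition of this file] -/
abbrev Letter := Fin 4 → Fin 4

/-- Sign ∕ parity patterns `δ ∈ (ℤ∕2)⁴`: the sign vector is `ε_k = (−1)^{δ_k}`; the same type indexes parity classes `p`.
[definition of this file] -/
abbrev Sgn := Fin 4 → Fin 2

/-- `i^k ∈ ℤ[i]`, computed from `k mod 4` (so that the kernel can evaluate it); see `ipow_eq_pow`. [definition of this file] -/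
def ipow (k : ℕ) : GaussianInt :=
  if k % 4 = 0 then 1 else if k % 4 = 1 then ⟨0, 1⟩ else if k % 4 = 2 then -1 else -⟨0, 1⟩

/-- `ipow k` IS the `k`-th power of `i = ⟨0, 1⟩` in `GaussianInt`. -/
theorem ipow_eq_pow (k : ℕ) : ipow k = (⟨0, 1⟩ : GaussianInt) ^ k := by
  have h4 : (⟨0, 1⟩ : GaussianInt) ^ 4 = 1 := by decide
  rw [← Nat.mod_add_div k 4, pow_add, pow_mul, h4, one_pow, mul_one]
  have hk : k % 4 < 4 := Nat.mod_lt _ (by norm_num)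
  unfold ipow
  rw [Nat.add_mul_mod_self_left, Nat.mod_mod]
  interval_cases (k % 4) <;> decide

/-- The exponent of `i` contributed by factor `k`: `ε_k x_k (mod 4)`, i.e. `x_k` if `δ_k = 0` and `3x_k ≡ −x_k` if `δ_k = 1`.
[definition of this file] -/
def sgnExp (d : Fin 2) (x : Fin 4) : ℕ := if d = 0 then x.val else 3 * x.val

/-- The character value `i^{ε(δ)·x}` of the letter vector `x` at the sign pattern `δ`. [definition of this file] -/
def chi (δ : Sgn) (x : Letter) : GaussianInt := ipow (∑ k, sgnExp (δ k) (x k))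

/-- The Walsh sign `(−1)^{δ·p}`. [definition of this file] -/
def wsign (δ p : Sgn) : ℤ := if (∑ k, (δ k).val * (p k).val) % 2 = 0 then 1 else -1

/-- The weight `|x| = Σ_k x_k` (as a natural number; only `|x| mod 4` matters). [definition of this file] -/
def wt (x : Letter) : ℕ := ∑ k, (x k).val

/-- The parity class `x mod 2 ∈ (ℤ∕2)⁴` of a letter vector. [definition of this file] -/
def par (x : Letter) : Sgn := fun k => ⟨(x k).val % 2, Nat.mod_lt _ (by norm_num)⟩

/-- The moment `m̂(ε(δ)) = Σ_x m(x)·i^{ε·x}` of an integer-valued design `m` (t-20 §1). [definition of this file] -/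
def moment (m : Letter → ℤ) (δ : Sgn) : GaussianInt := ∑ x, (m x : GaussianInt) * chi δ x

/-- The parity-class sums `S_p := Σ_{x ≡ p (mod 2)} m(x)·i^{|x|}` of LEMMA P. [definition of this file] -/
def S (m : Letter → ℤ) (p : Sgn) : GaussianInt := ∑ x, if par x = p then (m x : GaussianInt) * ipow (wt x) else 0

/-! ## §1 The two character identities (kernel `decide`) -/

/-- FIRST SENTENCE OF LEMMA P: «for ε ∈ {±1}ⁿ, i^{ε·x} = i^{|x|}·(−1)^{Σ_{k: ε_k = −1} x_k}» — for all 16 sign patterns and all 256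
letter vectors (kernel `decide`). -/
theorem chi_eq_ipow_wt_mul_sign : ∀ δ : Sgn, ∀ x : Letter,
    chi δ x = ipow (wt x) * (if (∑ k, (δ k).val * (x k).val) % 2 = 0 then 1 else -1) := by
  decide +kernel

/-- WALSH ORTHOGONALITY behind the inversion: `Σ_δ (−1)^{δ·p}·i^{ε(δ)·x} = 16·[x ≡ p (mod 2)]·i^{|x|}` for every letter vector `x` and
parity class `p` (kernel `decide`: 256 × 16 statements, 16 terms each). -/
theorem walsh_pointwise : ∀ x : Letter, ∀ p : Sgn,
    (∑ δ : Sgn, (wsign δ p : GaussianInt) * chi δ x) = if par x = p then 16 * ipow (wt x) else 0 := by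
  decide +kernel

/-! ## §2 The inversion and the formula for `S_p` -/

/-- **WALSH–HADAMARD INVERSION:** `16·S_p = Σ_δ (−1)^{δ·p}·m̂(δ)` for every integer design `m` and every parity class `p` («the
vector (m̂(ε))_ε is the Walsh–Hadamard transform of (S_p)_p», §2.2). -/
theorem inversion (m : Letter → ℤ) (p : Sgn) :
    16 * S m p = ∑ δ : Sgn, (wsign δ p : GaussianInt) * moment m δ := by
  calc 16 * S m p = ∑ x, (m x : GaussianInt) * (if par x = p then 16 * ipow (wt x) else 0) := by
        simp only [S, Finset.mul_sum]
        refine Finset.sum_congr rfl (fun x _ => ?_)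
        split_ifs <;> ring
    _ = ∑ x, (m x : GaussianInt) * ∑ δ : Sgn, (wsign δ p : GaussianInt) * chi δ x := by
        refine Finset.sum_congr rfl (fun x _ => ?_)
        rw [walsh_pointwise x p]
    _ = ∑ δ : Sgn, (wsign δ p : GaussianInt) * moment m δ := by
        simp only [moment, Finset.mul_sum]
        rw [Finset.sum_comm]
        refine Finset.sum_congr rfl (fun δ _ => Finset.sum_congr rfl (fun x _ => by ring))

/-- The all-plus pattern `δ = 0` has Walsh sign `+1` at every `p`. -/
theorem wsign_zero (p : Sgn) : wsign 0 p = 1 := by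
  simp [wsign]

/-- The all-minus pattern `δ = 1` has Walsh sign `(−1)^{|p|}`. -/
theorem wsign_one (p : Sgn) : wsign 1 p = if (∑ k, (p k).val) % 2 = 0 then 1 else -1 := by
  simp [wsign]

/-- A sign pattern is MIXED when it is neither all-plus (`0`) nor all-minus (`1`) — «mixed-sign ε ∈ {±1}ⁿ (2ⁿ − 2 conditions; 14 at
n = 4)». [definition of this file] -/
def Mixed (δ : Sgn) : Prop := δ ≠ 0 ∧ δ ≠ 1

/-- There are exactly 14 mixed sign patterns at n = 4. -/
theorem card_mixed : (Finset.univ.filter (fun δ : Sgn => δ ≠ 0 ∧ δ ≠ 1)).card = 14 := by decide +kernel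

/-- `ipow (3k) = conj (ipow k)`: replacing every `ε_k = +1` by `−1` conjugates the character. -/
theorem ipow_three_mul (k : ℕ) : ipow (3 * k) = star (ipow k) := by
  have hk : k % 4 < 4 := Nat.mod_lt _ (by norm_num)
  have h3 : 3 * k % 4 = 3 * (k % 4) % 4 := by omega
  unfold ipow
  rw [h3]
  interval_cases (k % 4) <;> decide

/-- `m̂(−,−,−,−) = conj m̂(+,+,+,+)` for an INTEGER-valued design («m̂(−1ⁿ) = ᾱ»). -/
theorem moment_one_eq_star (m : Letter → ℤ) : moment m 1 = star (moment m 0) := by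
  simp only [moment, star_sum, star_mul', star_intCast]
  refine Finset.sum_congr rfl (fun x _ => ?_)
  have h0 : chi 0 x = ipow (wt x) := by
    simp [chi, sgnExp, wt]
  have h1 : chi 1 x = ipow (3 * wt x) := by
    simp only [chi, sgnExp, wt, Pi.one_apply, one_ne_zero, if_false, Finset.mul_sum]
  rw [h0, h1, ipow_three_mul, mul_comm]

/-- **THE FORMULA FOR `S_p`:** if all 14 mixed moments vanish then `16·S_p = α + (−1)^{|p|}·ᾱ` with `α = m̂(+,+,+,+)` («invert to
S_p = 2^{−n}(α + (−1)^{|p|}ᾱ)», §2.2). -/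
theorem S_formula (m : Letter → ℤ) (hmixed : ∀ δ : Sgn, δ ≠ 0 → δ ≠ 1 → moment m δ = 0) (p : Sgn) :
    16 * S m p = moment m 0 + (wsign 1 p : GaussianInt) * star (moment m 0) := by
  rw [inversion, ← moment_one_eq_star]
  rw [Finset.sum_eq_add_of_mem (0 : Sgn) (1 : Sgn) (Finset.mem_univ _) (Finset.mem_univ _) (by decide)]
  · simp [wsign_zero]
  · intro δ _ hδ
    rw [hmixed δ hδ.1 hδ.2, mul_zero]

/-! ## §3 LEMMA P at n = 4 -/

/-- A non-zero parity-class sum `S_p ≠ 0` forces a letter of that parity class in the support of `m`. -/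
theorem exists_support_of_S_ne_zero (m : Letter → ℤ) (p : Sgn) (hS : S m p ≠ 0) : ∃ x, par x = p ∧ m x ≠ 0 := by
  by_contra h
  push Not at h
  apply hS
  refine Finset.sum_eq_zero (fun x _ => ?_)
  by_cases hx : par x = p
  · rw [if_pos hx, h x hx]; simp
  · rw [if_neg hx]

/-- Real and imaginary parts of `α + ᾱ` and `α − ᾱ` in `ℤ[i]`: `16·S_p` is `2·Re α` on even classes and `2i·Im α` on odd classes
(«S_p = Re α/2^{n−1} for |p| even and i·Im α/2^{n−1} for |p| odd»). -/
theorem S_formula_parts (m : Letter → ℤ) (hmixed : ∀ δ : Sgn, δ ≠ 0 → δ ≠ 1 → moment m δ = 0) (p : Sgn) :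
    16 * S m p = if (∑ k, (p k).val) % 2 = 0 then (⟨2 * (moment m 0).re, 0⟩ : GaussianInt)
      else (⟨0, 2 * (moment m 0).im⟩ : GaussianInt) := by
  rw [S_formula m hmixed p, wsign_one]
  split_ifs with h
  · ext <;> simp [two_mul]
  · ext <;> simp [two_mul]

/-- **LEMMA P at n = 4 (t-20 §2.2; census «minimum 8 at n = 4»):** an INTEGER-valued design `m : (ℤ∕4)⁴ → ℤ` (effective or signed)
whose 14 mixed-sign full moments vanish and whose moment `α = m̂(+,+,+,+)` is non-zero has at least `8 = 2^{n−1}` letter vectors in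
its support: if `Re α ≠ 0` every EVEN parity class carries support, if `Im α ≠ 0` every ODD one does, and there are 8 of each. -/
theorem eight_le_card_support (m : Letter → ℤ) (hmixed : ∀ δ : Sgn, δ ≠ 0 → δ ≠ 1 → moment m δ = 0)
    (halive : moment m 0 ≠ 0) : 8 ≤ (Finset.univ.filter (fun x : Letter => m x ≠ 0)).card := by
  -- the parity class chosen by α: even classes if Re α ≠ 0, odd classes otherwise (then Im α ≠ 0)
  have hparts : (moment m 0).re ≠ 0 ∨ (moment m 0).im ≠ 0 := by
    by_contra h
    push Not at h
    exact halive (Zsqrtd.ext h.1 h.2)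
  -- the family F of 8 parity classes all of whose S_p are non-zero
  obtain ⟨r, hr⟩ : ∃ r : ℕ, r < 2 ∧ ((r = 0 ∧ (moment m 0).re ≠ 0) ∨ (r = 1 ∧ (moment m 0).im ≠ 0)) := by
    rcases hparts with h | h
    · exact ⟨0, by norm_num, Or.inl ⟨rfl, h⟩⟩
    · exact ⟨1, by norm_num, Or.inr ⟨rfl, h⟩⟩
  set F : Finset Sgn := Finset.univ.filter (fun p : Sgn => (∑ k, (p k).val) % 2 = r) with hF
  have hFcard : F.card = 8 := by
    rcases hr.2 with ⟨h0, _⟩ | ⟨h1, _⟩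
    · rw [hF, h0]; decide +kernel
    · rw [hF, h1]; decide +kernel
  have hSne : ∀ p ∈ F, S m p ≠ 0 := by
    intro p hp hS0
    have hp' : (∑ k, (p k).val) % 2 = r := (Finset.mem_filter.mp hp).2
    have h16 := S_formula_parts m hmixed p
    rw [hS0, mul_zero] at h16
    rcases hr.2 with ⟨h0, hre⟩ | ⟨h1, him⟩
    · rw [if_pos (by omega)] at h16
      have := congrArg Zsqrtd.re h16
      simp at this
      exact hre (by linarith)
    · rw [if_neg (by omega)] at h16
      have := congrArg Zsqrtd.im h16
      simp at this
      exact him (by linarith)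
  -- par maps the support onto F's classes
  have hsub : F ⊆ (Finset.univ.filter (fun x : Letter => m x ≠ 0)).image par := by
    intro p hp
    obtain ⟨x, hx, hmx⟩ := exists_support_of_S_ne_zero m p (hSne p hp)
    exact Finset.mem_image.mpr ⟨x, Finset.mem_filter.mpr ⟨Finset.mem_univ x, hmx⟩, hx⟩
  calc 8 = F.card := hFcard.symm
    _ ≤ ((Finset.univ.filter (fun x : Letter => m x ≠ 0)).image par).card := Finset.card_le_card hsub
    _ ≤ (Finset.univ.filter (fun x : Letter => m x ≠ 0)).card := Finset.card_image_le

/-- COROLLARY (t-20 §2.4 (a) «≤ 3 graphs: … W-DEAD», and in fact every support of size < 8): an integer design whose 14 mixed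
moments vanish and whose support has FEWER THAN 8 letter vectors is W-DEAD: `m̂(+,+,+,+) = 0`. -/
theorem moment_zero_eq_zero_of_card_lt_eight (m : Letter → ℤ) (hmixed : ∀ δ : Sgn, δ ≠ 0 → δ ≠ 1 → moment m δ = 0)
    (hlt : (Finset.univ.filter (fun x : Letter => m x ≠ 0)).card < 8) : moment m 0 = 0 := by
  by_contra h
  have := eight_le_card_support m hmixed h
  omega

/-! ## §4 Non-vacuity and sharpness: t-20's minimal design Z₈ -/

/-- t-20's design **Z₈** (§2.3) by exponent vectors (letters i^{x_k}): 0000 = (1,1,1,1), 0031 = (1,1,−i,i), 0301 = (1,−i,1,i), 0310 =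
(1,−i,i,1), 1111 = (i,i,i,i), 3001 = (−i,1,1,i), 3010 = (−i,1,i,1), 3100 = (−i,i,1,1), each with multiplicity 1. [definition of this file] -/
def z8 : Letter → ℤ := fun x =>
  if x ∈ [![0,0,0,0], ![0,0,3,1], ![0,3,0,1], ![0,3,1,0], ![1,1,1,1], ![3,0,0,1], ![3,0,1,0], ![3,1,0,0]] then 1 else 0

/-- **Z₈ MEETS THE HYPOTHESES AND ATTAINS THE BOUND:** all 14 mixed moments of Z₈ vanish, `m̂(+,+,+,+) = 8 ≠ 0` (every letter
vector of Z₈ has weight `|x| ≡ 0 (mod 4)`, §2.3), and the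
support has exactly 8 letter vectors («equality iff the support is one letter-vector in each class of one parity family», §2.2; the
class cells of row B20-4 are t-20 ∣ t-22 ×2 and are NOT re-derived here). Kernel `decide`. -/
theorem z8_moments :
    (∀ δ : Sgn, δ ≠ 0 → δ ≠ 1 → moment z8 δ = 0) ∧ moment z8 0 = 8 ∧
      (Finset.univ.filter (fun x : Letter => z8 x ≠ 0)).card = 8 := by
  refine ⟨?_, by decide +kernel, by decide +kernel⟩
  decide +kernel

/-! ## §5 The «equality iff» clause of LEMMA P (appended by p9 g4 after p372343 landed; earlier declarations byte-identical) -/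

/-- If BOTH `Re α ≠ 0` and `Im α ≠ 0` then EVERY one of the 16 parity classes carries support, so the support has at least 16 letter
vectors (the two parity families are used simultaneously). -/
theorem sixteen_le_card_support (m : Letter → ℤ) (hmixed : ∀ δ : Sgn, δ ≠ 0 → δ ≠ 1 → moment m δ = 0)
    (hre : (moment m 0).re ≠ 0) (him : (moment m 0).im ≠ 0) :
    16 ≤ (Finset.univ.filter (fun x : Letter => m x ≠ 0)).card := by
  have hSne : ∀ p : Sgn, S m p ≠ 0 := by
    intro p hS0
    have h16 := S_formula_parts m hmixed p
    rw [hS0, mul_zero] at h16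
    split_ifs at h16 with h
    · have := congrArg Zsqrtd.re h16
      simp at this
      exact hre (by linarith)
    · have := congrArg Zsqrtd.im h16
      simp at this
      exact him (by linarith)
  have hsub : (Finset.univ : Finset Sgn) ⊆ (Finset.univ.filter (fun x : Letter => m x ≠ 0)).image par := by
    intro p _
    obtain ⟨x, hx, hmx⟩ := exists_support_of_S_ne_zero m p (hSne p)
    exact Finset.mem_image.mpr ⟨x, Finset.mem_filter.mpr ⟨Finset.mem_univ x, hmx⟩, hx⟩
  have hcard : (Finset.univ : Finset Sgn).card = 16 := by decide +kernel
  calc 16 = (Finset.univ : Finset Sgn).card := hcard.symm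
    _ ≤ ((Finset.univ.filter (fun x : Letter => m x ≠ 0)).image par).card := Finset.card_le_card hsub
    _ ≤ (Finset.univ.filter (fun x : Letter => m x ≠ 0)).card := Finset.card_image_le

/-- **«EQUALITY IFF», ONLY-IF HALF (α real or imaginary):** a design attaining the bound — 14 mixed moments 0, `α ≠ 0`, support of
size EXACTLY 8 — has `α` REAL or PURELY IMAGINARY (one parity family only). -/
theorem re_eq_zero_or_im_eq_zero_of_card_eq_eight (m : Letter → ℤ)
    (hmixed : ∀ δ : Sgn, δ ≠ 0 → δ ≠ 1 → moment m δ = 0)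
    (h8 : (Finset.univ.filter (fun x : Letter => m x ≠ 0)).card = 8) :
    (moment m 0).re = 0 ∨ (moment m 0).im = 0 := by
  by_contra h
  push Not at h
  have := sixteen_le_card_support m hmixed h.1 h.2
  omega

/-- **«EQUALITY IFF», ONLY-IF HALF (shape of the support):** in a design attaining the bound, EVERY parity class of the family chosen
by `α` (even classes if `Re α ≠ 0`, odd classes if `Im α ≠ 0`) contains EXACTLY ONE support letter, no support letter lies outside that
family, and `m(x)·i^{|x|}` is the SAME Gaussian integer for every support letter («equality iff the support is one letter-vector in each
class of one parity family with m(x)i^{|x|} constant», §2.2) — stated for the EVEN family (`Re α ≠ 0`); the odd family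
(`Im α ≠ 0`) is symmetric and not spelled out. -/
theorem card_eq_eight_shape_even (m : Letter → ℤ) (hmixed : ∀ δ : Sgn, δ ≠ 0 → δ ≠ 1 → moment m δ = 0)
    (hre : (moment m 0).re ≠ 0) (h8 : (Finset.univ.filter (fun x : Letter => m x ≠ 0)).card = 8) :
    (∀ p : Sgn, (∑ k, (p k).val) % 2 = 0 →
        ((Finset.univ.filter (fun x : Letter => m x ≠ 0)).filter (fun x => par x = p)).card = 1) ∧
      (∀ x : Letter, m x ≠ 0 → (∑ k, (par x k).val) % 2 = 0 ∧
        16 * ((m x : GaussianInt) * ipow (wt x)) = ⟨2 * (moment m 0).re, 0⟩) := by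
  have him : (moment m 0).im = 0 := by
    rcases re_eq_zero_or_im_eq_zero_of_card_eq_eight m hmixed h8 with h | h
    · exact absurd h hre
    · exact h
  set supp := Finset.univ.filter (fun x : Letter => m x ≠ 0) with hsupp
  set E : Finset Sgn := Finset.univ.filter (fun p : Sgn => (∑ k, (p k).val) % 2 = 0) with hE
  have hEcard : E.card = 8 := by rw [hE]; decide +kernel
  -- every even class carries support
  have hSne : ∀ p ∈ E, S m p ≠ 0 := by
    intro p hp hS0
    have hp' : (∑ k, (p k).val) % 2 = 0 := (Finset.mem_filter.mp hp).2
    have h16 := S_formula_parts m hmixed p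
    rw [hS0, mul_zero, if_pos hp'] at h16
    have := congrArg Zsqrtd.re h16
    simp at this
    exact hre (by linarith)
  have hnonempty : ∀ p ∈ E, 1 ≤ (supp.filter (fun x => par x = p)).card := by
    intro p hp
    obtain ⟨x, hx, hmx⟩ := exists_support_of_S_ne_zero m p (hSne p hp)
    exact Finset.card_pos.mpr ⟨x, Finset.mem_filter.mpr ⟨Finset.mem_filter.mpr ⟨Finset.mem_univ x, hmx⟩, hx⟩⟩
  -- the fibres of par over E are disjoint pieces of supp: Σ_{p ∈ E} #fibre ≤ #supp = 8, each ≥ 1, |E| = 8 ⇒ each = 1 and nothing else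
  have hsum_le : ∑ p ∈ E, (supp.filter (fun x => par x = p)).card ≤ supp.card := by
    rw [← Finset.card_biUnion]
    · exact Finset.card_le_card (Finset.biUnion_subset.mpr (fun p _ => Finset.filter_subset _ _))
    · intro p _ q _ hpq
      exact Finset.disjoint_filter.mpr (fun x _ hxp hxq => hpq (hxp.symm.trans hxq))
  have hsum_ge : E.card ≤ ∑ p ∈ E, (supp.filter (fun x => par x = p)).card := by
    rw [Finset.card_eq_sum_ones]
    exact Finset.sum_le_sum hnonempty
  have hfib : ∀ p ∈ E, (supp.filter (fun x => par x = p)).card = 1 := by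
    -- if some fibre had ≥ 2 elements the sum over the 8 classes would exceed #supp = 8
    intro p hp
    by_contra hne
    have hge2 : 2 ≤ (supp.filter (fun x => par x = p)).card := by
      have := hnonempty p hp; omega
    have hrest : (E.erase p).card ≤ ∑ q ∈ E.erase p, (supp.filter (fun x => par x = q)).card := by
      rw [Finset.card_eq_sum_ones]
      exact Finset.sum_le_sum (fun q hq => hnonempty q (Finset.mem_of_mem_erase hq))
    have hsplit := Finset.add_sum_erase E (fun q => (supp.filter (fun x => par x = q)).card) hp
    beta_reduce at hsplit
    have hEr : (E.erase p).card = 7 := by rw [Finset.card_erase_of_mem hp, hEcard]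
    rw [h8] at hsum_le
    omega
  have hsum_eq : ∑ p ∈ E, (supp.filter (fun x => par x = p)).card = 8 := by
    rw [Finset.sum_congr rfl hfib, ← Finset.card_eq_sum_ones, hEcard]
  refine ⟨fun p hp => hfib p (Finset.mem_filter.mpr ⟨Finset.mem_univ p, hp⟩), fun x hmx => ?_⟩
  -- a support letter outside the even family would make #supp ≥ 9
  have hxE : (∑ k, (par x k).val) % 2 = 0 := by
    by_contra hodd
    have hxmem : x ∈ supp := Finset.mem_filter.mpr ⟨Finset.mem_univ x, hmx⟩
    have hxnot : x ∉ E.biUnion (fun p => supp.filter (fun y => par y = p)) := by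
      intro hx
      obtain ⟨p, hp, hxp⟩ := Finset.mem_biUnion.mp hx
      have hpx : par x = p := (Finset.mem_filter.mp hxp).2
      exact hodd (hpx ▸ (Finset.mem_filter.mp hp).2)
    have hsub : insert x (E.biUnion (fun p => supp.filter (fun y => par y = p))) ⊆ supp :=
      Finset.insert_subset hxmem (Finset.biUnion_subset.mpr (fun p _ => Finset.filter_subset _ _))
    have hcard := Finset.card_le_card hsub
    rw [Finset.card_insert_of_notMem hxnot, Finset.card_biUnion] at hcard
    · rw [hsum_eq] at hcard; omega
    · intro p _ q _ hpq
      exact Finset.disjoint_filter.mpr (fun y _ hyp hyq => hpq (hyp.symm.trans hyq))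
  refine ⟨hxE, ?_⟩
  -- m(x)·i^{|x|} = S_{par x} since x is the only support letter of its class
  have hS : S m (par x) = (m x : GaussianInt) * ipow (wt x) := by
    have hone := hfib (par x) (Finset.mem_filter.mpr ⟨Finset.mem_univ _, hxE⟩)
    obtain ⟨y, hy⟩ := Finset.card_eq_one.mp hone
    have hxin : x ∈ supp.filter (fun z => par z = par x) :=
      Finset.mem_filter.mpr ⟨Finset.mem_filter.mpr ⟨Finset.mem_univ x, hmx⟩, rfl⟩
    rw [hy, Finset.mem_singleton] at hxin
    simp only [S]
    rw [Finset.sum_eq_single x]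
    · rw [if_pos rfl]
    · intro z _ hzx
      by_cases hz : par z = par x
      · rw [if_pos hz]
        by_cases hmz : m z = 0
        · simp [hmz]
        · exfalso
          have hzin : z ∈ supp.filter (fun w => par w = par x) :=
            Finset.mem_filter.mpr ⟨Finset.mem_filter.mpr ⟨Finset.mem_univ z, hmz⟩, hz⟩
          rw [hy, Finset.mem_singleton] at hzin
          exact hzx (hzin.trans hxin.symm)
      · rw [if_neg hz]
    · intro h; exact absurd (Finset.mem_univ x) h
  have h16 := S_formula_parts m hmixed (par x)
  rw [if_pos hxE, hS] at h16
  exact h16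

end Summit.Ventures.HSemireg.WalshParity
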